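import Summits.HubbardSuperconductivity.HubbardSuperconductivity.Theorems.AnisotropyChordSpinBlowUpLadder
import Literature.MathematicalPhysics.QuantumLattice.XYZGroundStateOrderHolds

/-!
# Route `AnisotropyChord`: the copy blow-up — THE XXZ HAMILTONIAN INTERTWINES
# (`H_{½}(blowUpGraph n G) · J = J · H_{n/2}(G)`; theory seat memo ROTOR-THEORY-6 §72)

From the ladder intertwining (`…SpinBlowUpLadder`):

* `fibreSpin_mul_blowUpIso` — `(Σ_i S^α_{(x,i)}) J = J S^α_x` for the three spin components;
* `fibreBond_mul_blowUpIso` — the `K_{n,n}` bundle of spin-½ bonds over a pair of sites acts as the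
  spin-`n/2` bond: `(Σ_i Σ_j B^α_{(x,i)(y,j)}) J = J B^α_{xy}`;
* `blowUp_edgeSum` — the edge sum of the blow-up graph `G.comap Prod.fst` regroups into the bundles over
  the edges of `G` (via the dart sums `sum_sum_ite_adj_eq_sum_edgeFinset`);
* `blowUp_xxzHamiltonian_mul_blowUpIso` — **`xxzHamiltonian 1 (blowUpGraph n G) J Δ * 𝐉 =
  𝐉 * xxzHamiltonian n G J Δ`** for every coupling and anisotropy: the spin-`n/2` XXZ model on `G` IS the
  spin-½ XXZ model on the blow-up restricted to the copy-symmetric subspace («the blow-up is just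
  another graph»).

Theory seat `hubbard-h0-rotor-theory-1` (memo ROTOR-THEORY-6 §72); Tasaki (2020) §2.1, §2.4.
No definition is introduced.
-/

set_option linter.dupNamespace false

noncomputable section

namespace Summit.HubbardSuperconductivity.HubbardSuperconductivity.Theorems.AnisotropyChord

open Matrix Complex Finset
open Literature.MathematicalPhysics.QuantumLattice

variable {V : Type} [Fintype V] [DecidableEq V]

/-! ### Spin components and bonds -/

/-- **Spin components intertwine:** `(Σ_i S^α_{(x,i)}) J = J S^α_x` for `α = x, y, z`.
Theory seat memo ROTOR-THEORY-6 §72; Tasaki (2020) §2.1. [folklore] -/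
theorem fibreSpin_mul_blowUpIso (n : ℕ) (x : V) (α : Fin 3) :
    ((∑ i : Fin n, (siteSpin 1 (x, i) α : Matrix (V × Fin n → Fin 2) (V × Fin n → Fin 2) ℂ)) *
        (blowUpIso n : Matrix (V × Fin n → Fin 2) (V → Fin (n + 1)) ℂ) :
        Matrix (V × Fin n → Fin 2) (V → Fin (n + 1)) ℂ) =
      ((blowUpIso n : Matrix (V × Fin n → Fin 2) (V → Fin (n + 1)) ℂ) *
        (siteSpin n x α : Matrix (V → Fin (n + 1)) (V → Fin (n + 1)) ℂ) :
        Matrix (V × Fin n → Fin 2) (V → Fin (n + 1)) ℂ) := by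
  have hP := fibreRaise_mul_blowUpIso (V := V) n x
  have hM := fibreLower_mul_blowUpIso (V := V) n x
  have hZ := fibreZ_mul_blowUpIso (V := V) n x
  fin_cases α
  · -- `Sˣ = ½ (S⁺ + S⁻)`
    simp only [siteSpin, Fin.zero_eta, spinVec_zero, spinX, onSite_smul', onSite_add', ← Finset.smul_sum,
      Finset.sum_add_distrib, Matrix.smul_mul, Matrix.mul_smul, Matrix.add_mul, Matrix.mul_add, hP, hM]
  · -- `Sʸ = (S⁺ − S⁻)/(2i)`
    simp only [siteSpin, Fin.mk_one, spinVec_one, spinY, onSite_smul', onSite_sub', ← Finset.smul_sum,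
      Finset.sum_sub_distrib, Matrix.smul_mul, Matrix.mul_smul, Matrix.sub_mul, Matrix.mul_sub, hP, hM]
  · -- `Sᶻ`
    simp only [siteSpin, Fin.reduceFinMk, spinVec_two, hZ]

/-- **Bonds intertwine:** for distinct sites `x ≠ y`, `(Σ_i Σ_j B^α_{(x,i)(y,j)}) J = J B^α_{xy}` with
`B^α = ½ (S^α S^α + S^α S^α)` the symmetrised bond of the tree (`spinBond`).  Theory seat memo
ROTOR-THEORY-6 §72. [folklore] -/
theorem fibreBond_mul_blowUpIso (n : ℕ) (x y : V) (α : Fin 3) :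
    ((∑ i : Fin n, ∑ j : Fin n,
        (spinBond 1 α (x, i) (y, j) : Matrix (V × Fin n → Fin 2) (V × Fin n → Fin 2) ℂ)) *
        (blowUpIso n : Matrix (V × Fin n → Fin 2) (V → Fin (n + 1)) ℂ) :
        Matrix (V × Fin n → Fin 2) (V → Fin (n + 1)) ℂ) =
      ((blowUpIso n : Matrix (V × Fin n → Fin 2) (V → Fin (n + 1)) ℂ) *
        (spinBond n α x y : Matrix (V → Fin (n + 1)) (V → Fin (n + 1)) ℂ) :
        Matrix (V × Fin n → Fin 2) (V → Fin (n + 1)) ℂ) := by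
  set J : Matrix (V × Fin n → Fin 2) (V → Fin (n + 1)) ℂ := blowUpIso n with hJ
  set Fx : Matrix (V × Fin n → Fin 2) (V × Fin n → Fin 2) ℂ :=
    ∑ i : Fin n, (siteSpin 1 (x, i) α : Matrix (V × Fin n → Fin 2) (V × Fin n → Fin 2) ℂ) with hFx
  set Fy : Matrix (V × Fin n → Fin 2) (V × Fin n → Fin 2) ℂ :=
    ∑ j : Fin n, (siteSpin 1 (y, j) α : Matrix (V × Fin n → Fin 2) (V × Fin n → Fin 2) ℂ) with hFy
  have hx : Fx * J = J * (siteSpin n x α : Matrix (V → Fin (n + 1)) (V → Fin (n + 1)) ℂ) :=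
    fibreSpin_mul_blowUpIso n x α
  have hy : Fy * J = J * (siteSpin n y α : Matrix (V → Fin (n + 1)) (V → Fin (n + 1)) ℂ) :=
    fibreSpin_mul_blowUpIso n y α
  -- the double sum of bonds is the symmetrised product of the fibre spins
  have hsum : (∑ i : Fin n, ∑ j : Fin n,
      (spinBond 1 α (x, i) (y, j) : Matrix (V × Fin n → Fin 2) (V × Fin n → Fin 2) ℂ)) =
      (1 / 2 : ℂ) • (Fx * Fy + Fy * Fx) := by
    rw [hFx, hFy, Finset.sum_mul_sum, Finset.sum_mul_sum, Finset.sum_comm (f := fun j i =>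
      (siteSpin 1 (y, j) α : Matrix (V × Fin n → Fin 2) (V × Fin n → Fin 2) ℂ) * siteSpin 1 (x, i) α),
      ← Finset.sum_add_distrib, Finset.smul_sum]
    refine Finset.sum_congr rfl fun i _ => ?_
    rw [← Finset.sum_add_distrib, Finset.smul_sum]
    refine Finset.sum_congr rfl fun j _ => ?_
    rfl
  rw [hsum, Matrix.smul_mul, Matrix.add_mul, Matrix.mul_assoc, hy, ← Matrix.mul_assoc, hx, Matrix.mul_assoc,
    Matrix.mul_assoc Fy, hx, ← Matrix.mul_assoc Fy, hy, Matrix.mul_assoc, ← Matrix.mul_add, ← Matrix.mul_smul]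
  rfl

/-! ### The edge sum of the blow-up graph -/

/-- **Edges of the blow-up are the bundles over the edges:** for a symmetric matrix-valued `f` on
pairs of blown-up sites, `Σ_{e' ∈ E(G')} f(e') = Σ_{e = xy ∈ E(G)} Σ_i Σ_j f((x,i),(y,j))`. [folklore] -/
theorem blowUp_edgeSum (n : ℕ) (G : SimpleGraph V) [DecidableRel G.Adj]
    (f : V × Fin n → V × Fin n → Matrix (V × Fin n → Fin 2) (V → Fin (n + 1)) ℂ)
    (hf : ∀ a b, f a b = f b a) :
    ∑ e ∈ (blowUpGraph n G).edgeFinset, Sym2.lift ⟨f, hf⟩ e =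
      ∑ e ∈ G.edgeFinset, Sym2.lift ⟨fun x y => ∑ i : Fin n, ∑ j : Fin n, f (x, i) (y, j), fun x y => by
        dsimp only
        rw [Finset.sum_comm]
        exact Finset.sum_congr rfl fun j _ => Finset.sum_congr rfl fun i _ => hf _ _⟩ e := by
  -- both sides, doubled, are the dart sums
  have h1 := sum_sum_ite_adj_eq_sum_edgeFinset (blowUpGraph n G) f
  have h2 := sum_sum_ite_adj_eq_sum_edgeFinset G (fun x y => ∑ i : Fin n, ∑ j : Fin n, f (x, i) (y, j))
  have hdart : (∑ a : V × Fin n, ∑ b : V × Fin n, if (blowUpGraph n G).Adj a b then f a b else 0) =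
      ∑ x, ∑ y, if G.Adj x y then ∑ i : Fin n, ∑ j : Fin n, f (x, i) (y, j) else 0 := by
    rw [Fintype.sum_prod_type]
    refine Finset.sum_congr rfl fun x _ => ?_
    rw [Finset.sum_comm, Fintype.sum_prod_type]
    refine Finset.sum_congr rfl fun y _ => ?_
    simp only [SimpleGraph.comap_adj]
    by_cases hxy : G.Adj x y
    · simp only [if_pos hxy]
      rw [Finset.sum_comm]
    · simp only [if_neg hxy, Finset.sum_const_zero]
  -- `Σ lift(f + fᵀ) = 2 • Σ lift f` on both graphs
  have hdouble : ∀ {W : Type} [Fintype W] [DecidableEq W] (H : SimpleGraph W) [DecidableRel H.Adj]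
      (g : W → W → Matrix (V × Fin n → Fin 2) (V → Fin (n + 1)) ℂ) (hg : ∀ a b, g a b = g b a),
      ∑ e ∈ H.edgeFinset, Sym2.lift ⟨fun a b => g a b + g b a, fun _ _ => add_comm _ _⟩ e =
        (2 : ℂ) • ∑ e ∈ H.edgeFinset, Sym2.lift ⟨g, hg⟩ e := by
    intro W _ _ H _ g hg
    rw [Finset.smul_sum]
    refine Finset.sum_congr rfl fun e _ => ?_
    induction e using Sym2.ind with
    | h a b =>
      simp only [Sym2.lift_mk]
      rw [hg b a, two_smul]
  have hfsymm : ∀ x y : V, (∑ i : Fin n, ∑ j : Fin n, f (x, i) (y, j)) = ∑ i : Fin n, ∑ j : Fin n, f (y, i) (x, j) := by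
    intro x y
    rw [Finset.sum_comm]
    exact Finset.sum_congr rfl fun j _ => Finset.sum_congr rfl fun i _ => hf _ _
  rw [hdouble (blowUpGraph n G) f hf] at h1
  rw [hdouble G (fun x y => ∑ i : Fin n, ∑ j : Fin n, f (x, i) (y, j)) hfsymm] at h2
  have h := h1.symm.trans (hdart.trans h2)
  exact smul_right_injective _ (two_ne_zero (α := ℂ)) h

/-! ### The Hamiltonian intertwines -/

/-- **The blown-up spin-½ XXZ Hamiltonian acts on the symmetrised states as the spin-`n/2` XXZ
Hamiltonian:** `H_{½}(G', J, Δ) · 𝐉 = 𝐉 · H_{n/2}(G, J, Δ)`, `G' = blowUpGraph n G`, for every coupling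
`J` and anisotropy `Δ`.  Theory seat memo ROTOR-THEORY-6 §72 («the blow-up is just another graph»);
Tasaki (2020) §2.1, §2.4. [folklore] -/
theorem blowUp_xxzHamiltonian_mul_blowUpIso (n : ℕ) (G : SimpleGraph V) [DecidableRel G.Adj] (Jc Δ : ℝ) :
    ((xxzHamiltonian 1 (blowUpGraph n G) Jc Δ : Matrix (V × Fin n → Fin 2) (V × Fin n → Fin 2) ℂ) *
        (blowUpIso n : Matrix (V × Fin n → Fin 2) (V → Fin (n + 1)) ℂ) :
        Matrix (V × Fin n → Fin 2) (V → Fin (n + 1)) ℂ) =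
      ((blowUpIso n : Matrix (V × Fin n → Fin 2) (V → Fin (n + 1)) ℂ) *
        (xxzHamiltonian n G Jc Δ : Matrix (V → Fin (n + 1)) (V → Fin (n + 1)) ℂ) :
        Matrix (V × Fin n → Fin 2) (V → Fin (n + 1)) ℂ) := by
  set J : Matrix (V × Fin n → Fin 2) (V → Fin (n + 1)) ℂ := blowUpIso n with hJ
  -- bond function of the blow-up, multiplied by `J` on the right
  set f : V × Fin n → V × Fin n → Matrix (V × Fin n → Fin 2) (V → Fin (n + 1)) ℂ := fun a b =>
    ((spinBond 1 0 a b + spinBond 1 1 a b + (Δ : ℂ) • spinBond 1 2 a b :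
      Matrix (V × Fin n → Fin 2) (V × Fin n → Fin 2) ℂ)) * J with hf
  have hfs : ∀ a b, f a b = f b a := fun a b => by simp only [hf, spinBond_comm]
  -- push `* J` inside the edge sum of the blow-up
  have hL : ((xxzHamiltonian 1 (blowUpGraph n G) Jc Δ : Matrix (V × Fin n → Fin 2) (V × Fin n → Fin 2) ℂ) *
      J) = (Jc : ℂ) • ∑ e ∈ (blowUpGraph n G).edgeFinset, Sym2.lift ⟨f, hfs⟩ e := by
    rw [xxzHamiltonian, Matrix.smul_mul, Matrix.sum_mul]
    congr 1
    refine Finset.sum_congr rfl fun e _ => ?_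
    induction e using Sym2.ind with
    | h a b => simp only [Sym2.lift_mk, hf]
  -- regroup over the edges of `G` and intertwine bond by bond
  have hR : ∑ e ∈ (blowUpGraph n G).edgeFinset, Sym2.lift ⟨f, hfs⟩ e =
      J * ∑ e ∈ G.edgeFinset, Sym2.lift ⟨fun x y =>
        (spinBond n 0 x y + spinBond n 1 x y + (Δ : ℂ) • spinBond n 2 x y :
          Matrix (V → Fin (n + 1)) (V → Fin (n + 1)) ℂ), fun x y => by simp only [spinBond_comm]⟩ e := by
    rw [blowUp_edgeSum n G f hfs, Matrix.mul_sum]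
    refine Finset.sum_congr rfl fun e he => ?_
    induction e using Sym2.ind with
    | h x y =>
      simp only [Sym2.lift_mk]
      have hb0 := fibreBond_mul_blowUpIso (V := V) n x y 0
      have hb1 := fibreBond_mul_blowUpIso (V := V) n x y 1
      have hb2 := fibreBond_mul_blowUpIso (V := V) n x y 2
      simp only [hf, Matrix.add_mul, Matrix.smul_mul, Finset.sum_add_distrib, ← Finset.smul_sum]
      rw [← hJ] at hb0 hb1 hb2
      simp only [Matrix.sum_mul] at hb0 hb1 hb2
      rw [hb0, hb1, hb2, Matrix.mul_add, Matrix.mul_add, Matrix.mul_smul]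
  rw [hL, hR, xxzHamiltonian, Matrix.mul_smul]


end Summit.HubbardSuperconductivity.HubbardSuperconductivity.Theorems.AnisotropyChord
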